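import Summits.QuantumFields.YangMills.Theorems.PencilRigidityNPointIsotropyOneAngleSkew

/-!
# One-angle amplification, II: the circle group of the irrational skew rotation (closed subgroups of `ℝ`)

Support file (registered sub-goal `oneAngleCircle` of stub `stub_oneAngleAmplification`, crux `stmt-QuantumFields-11686`
`Summit.QuantumFields.YangMills.Theses.PencilRigidity.NPointIsotropy`, line `quarter-turn-corner-operator`).
Namespace `…NPointIsotropy.QuarterTurnCornerOperator`, helpers in the sub-namespace `OneAngle`; no `def`, no
notation. `E4 = EuclideanSpace ℝ (Fin 4)`, `ρ t = planeRot (d := 3) 0 t` (rotation of the `(x₀,x₁)`-plane).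

**Main theorem** `oneAngleCircle`. Let `P` be a predicate on the linear isometries of `ℝ⁴` which is closed under
composition and inverses, holds on every proper signed permutation (determinant one, axes to `±` axes), holds on
every eighth-turn `R₈` of the `(x₀,x₁)`-plane (`R₈ e₀ = (√2/2)(e₀ + e₁)`, `R₈ e₁ = (√2/2)(-e₀ + e₁)`, `e₂, e₃` fixed),
and is CLOSED along conjugate one-parameter families of plane rotations: `{t : ℝ | P (A ∘ ρ t ∘ B)}` is closed for
all isometries `A, B` (for the invariance predicate of a tempered family on `⁰𝒮` this is the continuity of
`t ↦ F ∘ ρ(-t)` in `𝓢`). Then `P` holds on every determinant-one isometry fixing `e₃` and the vector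
`v = e₀ + (1 + √2) e₁ + e₂` — the full circle group of rotations of `ℝ⁴` about the axis `v` inside `Stab(e₃)`.

Informal proof. By `oneAngleSkew` (file I) the skew rotation `h = Q_A ∘ R₈` (`Q_A` the quarter-turn
`e₀ ↦ -e₂, e₂ ↦ e₀`, a proper signed permutation; `h ∈ P`) is `P₀⁻¹ ρ(φ₀) P₀` in a frame `P₀` adapted to `v`, with
`φ₀/2π` irrational, and every determinant-one isometry fixing `v, e₃` is some `P₀⁻¹ ρ(t) P₀`. The set
`Θ = {t | P (P₀⁻¹ ρ(t) P₀)}` is an additive subgroup of `ℝ` (`ρ` is a one-parameter group: tree `Upgrade.rho_add`,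
`rho_zero`, `rho_symm`), closed by hypothesis, and contains `φ₀` and `2π` (`ρ(2π) = 1`). By Kronecker's theorem
(Mathlib `dense_addSubgroupClosure_pair_iff`) `ℤφ₀ + 2πℤ` is dense, so `Θ = ℝ`.

References: folklore (closed subgroups of `ℝ`; Kronecker). Companion files: `…OneAngleSkew` (I), `…OneAngleAxis`
(III: moving the axis `v` to `e₂`), `…OneAngleAmplification` (the stub).
-/

noncomputable section

namespace Summit.QuantumFields.YangMills.Theorems.NPointIsotropy.QuarterTurnCornerOperator

open scoped InnerProductSpace Topology
open Literature.MathematicalPhysics.QuantumFieldTheory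
open Summit.QuantumFields.YangMills.Theorems.NPointIsotropy.Negative (E4)
open Summit.QuantumFields.YangMills.Theorems.PlanarToEuclidean
open Summit.QuantumFields.YangMills.Theorems.OSLegsFromFemtoAndGap.Upgrade

namespace OneAngle

section Generation

variable (P : (E4 ≃ₗᵢ[ℝ] E4) → Prop)

/-- **All conjugate plane rotations from one irrational one.** If `P` is closed under composition and inverses,
holds at the identity, `{t | P (A ∘ ρ t ∘ A⁻¹)}` (read as `(A.trans (ρ t)).trans A.symm`) is closed, and `P` holds
on `(A.trans (ρ φ₀)).trans A.symm` for some `φ₀` with `φ₀/2π` irrational, then it holds on every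
`(A.trans (ρ t)).trans A.symm`: a closed additive subgroup of `ℝ` containing `φ₀` and `2π` is dense (Kronecker),
hence everything. [folklore] -/
theorem conj_rho_all (hmul : ∀ A B, P A → P B → P (A.trans B)) (hinv : ∀ A, P A → P A.symm)
    (hone : P (LinearIsometryEquiv.refl ℝ E4)) (A : E4 ≃ₗᵢ[ℝ] E4)
    (hclosed : IsClosed {t : ℝ | P ((A.trans (planeRot (d := 3) 0 t)).trans A.symm)})
    {φ₀ : ℝ} (hirr : Irrational (φ₀ / (2 * Real.pi))) (hφ₀ : P ((A.trans (planeRot (d := 3) 0 φ₀)).trans A.symm))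
    (t : ℝ) : P ((A.trans (planeRot (d := 3) 0 t)).trans A.symm) := by
  let Θ : AddSubgroup ℝ :=
    { carrier := {t : ℝ | P ((A.trans (planeRot (d := 3) 0 t)).trans A.symm)}
      zero_mem' := by
        show P ((A.trans (planeRot (d := 3) 0 0)).trans A.symm)
        have h0 : (A.trans (planeRot (d := 3) 0 0)).trans A.symm = LinearIsometryEquiv.refl ℝ E4 := by
          rw [rho_zero]
          ext x : 1
          simp
        rw [h0]
        exact hone
      add_mem' := fun {a b} ha hb => by
        show P ((A.trans (planeRot (d := 3) 0 (a + b))).trans A.symm)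
        have hab : (A.trans (planeRot (d := 3) 0 (a + b))).trans A.symm =
            ((A.trans (planeRot (d := 3) 0 a)).trans A.symm).trans ((A.trans (planeRot (d := 3) 0 b)).trans A.symm) := by
          rw [rho_add]
          ext x : 1
          simp
        rw [hab]
        exact hmul _ _ ha hb
      neg_mem' := fun {a} ha => by
        show P ((A.trans (planeRot (d := 3) 0 (-a))).trans A.symm)
        have hna : (A.trans (planeRot (d := 3) 0 (-a))).trans A.symm =
            ((A.trans (planeRot (d := 3) 0 a)).trans A.symm).symm := by
          rw [← rho_symm]
          ext x : 1
          simp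
        rw [hna]
        exact hinv _ ha }
  have hΘc : IsClosed (Θ : Set ℝ) := hclosed
  have hφΘ : φ₀ ∈ Θ := hφ₀
  have h2πΘ : (2 * Real.pi) ∈ Θ := by
    show P ((A.trans (planeRot (d := 3) 0 (2 * Real.pi))).trans A.symm)
    have h0 : (A.trans (planeRot (d := 3) 0 (2 * Real.pi))).trans A.symm = LinearIsometryEquiv.refl ℝ E4 := by
      have h2π : (planeRot (d := 3) 0 (2 * Real.pi) : E4 ≃ₗᵢ[ℝ] E4) = LinearIsometryEquiv.refl ℝ E4 := by
        rw [← rho_zero]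
        ext x j
        simp only [planeRot_apply, Real.cos_two_pi, Real.sin_two_pi, Real.cos_zero, Real.sin_zero]
      ext x : 1
      simp [h2π]
    rw [h0]
    exact hone
  have hΘ : (Θ : Set ℝ) = Set.univ := by
    have hd : Dense (Θ : Set ℝ) := by
      have hle : AddSubgroup.closure {φ₀, 2 * Real.pi} ≤ Θ := by
        rw [AddSubgroup.closure_le]
        intro x hx
        rcases hx with rfl | rfl
        · exact hφΘ
        · exact h2πΘ
      exact (dense_addSubgroupClosure_pair_iff.2 hirr).mono hle
    rw [← hΘc.closure_eq, hd.closure_eq]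
  exact (hΘ ▸ Set.mem_univ t : t ∈ (Θ : Set ℝ))

/-- **The full circle group about the skew axis.** Let `P` be a predicate on the linear isometries of `ℝ⁴`,
closed under composition and inverses, holding on every proper signed permutation and on every eighth-turn
`R₈` of the `(x₀,x₁)`-plane, and closed along every conjugate one-parameter family of plane rotations
(`{t | P (A ∘ ρ t ∘ B)}` closed). Then `P` holds on every determinant-one isometry fixing `e₃` and
`v = e₀ + (1+√2) e₁ + e₂`: by `skew_conj` (file I) `Q_A ∘ R₈ = P₀⁻¹ρ(φ₀)P₀ ∈ P` with `φ₀/2π` irrational, so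
(`conj_rho_all`) every `P₀⁻¹ρ(t)P₀ ∈ P`, and these exhaust the determinant-one isometries fixing `v, e₃`. [folklore] -/
theorem circle_of_closed (hmul : ∀ A B, P A → P B → P (A.trans B)) (hinv : ∀ A, P A → P A.symm)
    (hhyper : ∀ A : E4 ≃ₗᵢ[ℝ] E4, LinearMap.det (A.toLinearEquiv : E4 →ₗ[ℝ] E4) = 1 →
      (∀ i : Fin 4, ∃ j : Fin 4, A (EuclideanSpace.single i 1) = EuclideanSpace.single j 1 ∨
        A (EuclideanSpace.single i 1) = -EuclideanSpace.single j 1) → P A)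
    (h8 : ∀ R₈ : E4 ≃ₗᵢ[ℝ] E4,
      (R₈ (EuclideanSpace.single 0 1) =
          (Real.sqrt 2 / 2) • EuclideanSpace.single 0 1 + (Real.sqrt 2 / 2) • EuclideanSpace.single 1 1 ∧
        R₈ (EuclideanSpace.single 1 1) =
          -((Real.sqrt 2 / 2) • EuclideanSpace.single 0 1) + (Real.sqrt 2 / 2) • EuclideanSpace.single 1 1 ∧
        R₈ (EuclideanSpace.single 2 1) = EuclideanSpace.single 2 1 ∧
        R₈ (EuclideanSpace.single 3 1) = EuclideanSpace.single 3 1) → P R₈)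
    (hclosed : ∀ A B : E4 ≃ₗᵢ[ℝ] E4, IsClosed {t : ℝ | P ((A.trans (planeRot (d := 3) 0 t)).trans B)})
    (R : E4 ≃ₗᵢ[ℝ] E4) (hR : LinearMap.det (R.toLinearEquiv : E4 →ₗ[ℝ] E4) = 1)
    (hRv : R (EuclideanSpace.single 0 1 + (1 + Real.sqrt 2) • EuclideanSpace.single 1 1 + EuclideanSpace.single 2 1) =
      EuclideanSpace.single 0 1 + (1 + Real.sqrt 2) • EuclideanSpace.single 1 1 + EuclideanSpace.single 2 1)
    (hR3 : R (EuclideanSpace.single 3 1) = EuclideanSpace.single 3 1) : P R := by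
  -- the identity
  have hone : P (LinearIsometryEquiv.refl ℝ E4) := by
    refine hhyper _ ?_ fun i => ⟨i, Or.inl rfl⟩
    have h : ((LinearIsometryEquiv.refl ℝ E4).toLinearEquiv : E4 →ₗ[ℝ] E4) = LinearMap.id := rfl
    rw [h, LinearMap.det_id]
  -- the quarter-turn conjugator `Q_A` and the eighth-turn
  obtain ⟨hQdet, hQ0, hQ1, hQ2, hQ3⟩ := QA_spec
  set Q : E4 ≃ₗᵢ[ℝ] E4 := ((Submodule.span ℝ {(EuclideanSpace.single 0 1 : E4)})ᗮ.reflection).trans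
    ((Submodule.span ℝ {(EuclideanSpace.single 0 1 - EuclideanSpace.single 2 1 : E4)})ᗮ.reflection) with hQdef
  have hPQ : P Q := by
    refine hhyper Q hQdet fun i => ?_
    fin_cases i
    · exact ⟨2, Or.inr hQ0⟩
    · exact ⟨1, Or.inl hQ1⟩
    · exact ⟨0, Or.inl hQ2⟩
    · exact ⟨3, Or.inl hQ3⟩
  set R₈ : E4 ≃ₗᵢ[ℝ] E4 := planeRot (d := 3) 0 (-(Real.pi / 4)) with hR₈
  have h8spec : R₈ (EuclideanSpace.single 0 1) =
        (Real.sqrt 2 / 2) • EuclideanSpace.single 0 1 + (Real.sqrt 2 / 2) • EuclideanSpace.single 1 1 ∧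
      R₈ (EuclideanSpace.single 1 1) =
        -((Real.sqrt 2 / 2) • EuclideanSpace.single 0 1) + (Real.sqrt 2 / 2) • EuclideanSpace.single 1 1 ∧
      R₈ (EuclideanSpace.single 2 1) = EuclideanSpace.single 2 1 ∧
      R₈ (EuclideanSpace.single 3 1) = EuclideanSpace.single 3 1 :=
    ⟨eighthTurn_e0, eighthTurn_e1, rho_e2 _, rho_e3 _⟩
  have hPh : P (R₈.trans Q) := hmul _ _ (h8 R₈ h8spec) hPQ
  -- file I: the skew rotation is an irrational conjugate plane rotation in a frame adapted to `v`
  obtain ⟨P₀, c, φ₀, -, -, -, hφ₀, hirr, hconj⟩ := skew_conj R₈ Q h8spec hQdet ⟨hQ0, hQ1, hQ2, hQ3⟩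
  rw [hφ₀] at hPh
  obtain ⟨t, rfl⟩ := hconj R hR hRv hR3
  exact conj_rho_all P hmul hinv hone P₀ (hclosed P₀ P₀.symm) hirr hPh t

end Generation

end OneAngle

/-- **Registered sub-goal `oneAngleCircle` of stub `stub_oneAngleAmplification`** (= `OneAngle.circle_of_closed`
over Mathlib/tree vocabulary): a predicate on the linear isometries of `ℝ⁴` closed under composition and inverses,
holding on the proper signed permutations and on the eighth-turns of the `(x₀,x₁)`-plane, and closed along
conjugate families of plane rotations, holds on every determinant-one isometry fixing `e₃` and
`e₀ + (1+√2) e₁ + e₂`. [folklore] -/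
theorem oneAngleCircle :
    ∀ (P : (EuclideanSpace ℝ (Fin 4) ≃ₗᵢ[ℝ] EuclideanSpace ℝ (Fin 4)) → Prop),
      (∀ A B, P A → P B → P (A.trans B)) → (∀ A, P A → P A.symm) →
      (∀ A : EuclideanSpace ℝ (Fin 4) ≃ₗᵢ[ℝ] EuclideanSpace ℝ (Fin 4),
        LinearMap.det (A.toLinearEquiv : EuclideanSpace ℝ (Fin 4) →ₗ[ℝ] EuclideanSpace ℝ (Fin 4)) = 1 →
        (∀ i : Fin 4, ∃ j : Fin 4, A (EuclideanSpace.single i 1) = EuclideanSpace.single j 1 ∨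
          A (EuclideanSpace.single i 1) = -EuclideanSpace.single j 1) → P A) →
      (∀ R₈ : EuclideanSpace ℝ (Fin 4) ≃ₗᵢ[ℝ] EuclideanSpace ℝ (Fin 4),
        (R₈ (EuclideanSpace.single 0 1) =
            (Real.sqrt 2 / 2) • EuclideanSpace.single 0 1 + (Real.sqrt 2 / 2) • EuclideanSpace.single 1 1 ∧
          R₈ (EuclideanSpace.single 1 1) =
            -((Real.sqrt 2 / 2) • EuclideanSpace.single 0 1) + (Real.sqrt 2 / 2) • EuclideanSpace.single 1 1 ∧
          R₈ (EuclideanSpace.single 2 1) = EuclideanSpace.single 2 1 ∧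
          R₈ (EuclideanSpace.single 3 1) = EuclideanSpace.single 3 1) → P R₈) →
      (∀ A B : EuclideanSpace ℝ (Fin 4) ≃ₗᵢ[ℝ] EuclideanSpace ℝ (Fin 4),
        IsClosed {t : ℝ | P ((A.trans
          (Literature.MathematicalPhysics.QuantumFieldTheory.planeRot (d := 3) 0 t)).trans B)}) →
      ∀ R : EuclideanSpace ℝ (Fin 4) ≃ₗᵢ[ℝ] EuclideanSpace ℝ (Fin 4),
        LinearMap.det (R.toLinearEquiv : EuclideanSpace ℝ (Fin 4) →ₗ[ℝ] EuclideanSpace ℝ (Fin 4)) = 1 →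
        R (EuclideanSpace.single 0 1 + (1 + Real.sqrt 2) • EuclideanSpace.single 1 1 + EuclideanSpace.single 2 1) =
          EuclideanSpace.single 0 1 + (1 + Real.sqrt 2) • EuclideanSpace.single 1 1 + EuclideanSpace.single 2 1 →
        R (EuclideanSpace.single 3 1) = EuclideanSpace.single 3 1 → P R :=
  fun P hmul hinv hhyper h8 hclosed R hR hRv hR3 =>
    OneAngle.circle_of_closed P hmul hinv hhyper h8 hclosed R hR hRv hR3

end Summit.QuantumFields.YangMills.Theorems.NPointIsotropy.QuarterTurnCornerOperator

end
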